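import Literature.NumberTheory.LFunctions.HyperbolaPrimeSumAbel
import HarnessLib

/-!
# Discrete Abel summation against a Chebyshev-type function: the sharp form

Topic `Literature/NumberTheory/LFunctions` (sequel to `HyperbolaPrimeSumAbel.lean`). Everything here is
PROVED; no definitions, no named facts. The tree's `HyperbolaAbel.abs_sum_weight_mul_sub_sum_le`
bounds `|∑_{N ≤ k ≤ X} (c(k) − 1) M(⌊X/k⌋)/(k log k)|` by `C₁(4B + K)/log²(N − 1)`, where
`K ≥ ∑_{n ≤ X/N} |w(n)|`. In the application to the friable Möbius–root sum `K ≍ log(X/N)` grows like a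
logarithm, and the proof actually gives the `K`-term with a THIRD power of the logarithm:

* `abs_sum_weight_mul_sub_sum_le_sharp` — same hypotheses, conclusion
  `≤ 3 C₁ B/log²(N − 1) + C₁ K/log³ N`.

The proof is the tree's, with the last weakening `1/log³ N ≤ 1/log²(N − 1)` omitted.

## References

* H. L. Montgomery, R. C. Vaughan, *Multiplicative Number Theory I*, CUP 2007, §2.1 (summation by
  parts). [MontgomeryVaughan2007]
-/

open Finset Real

noncomputable section

namespace Literature.NumberTheory.LFunctions

namespace HyperbolaAbel

/-- `k (log (k+1) − log k) ≤ 1` for `k ≥ 1` (i.e. `log (1 + 1/k) ≤ 1/k`). [folklore] -/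
private theorem mul_log_succ_sub_log_le_one' {k : ℕ} (hk : 1 ≤ k) :
    (k : ℝ) * (Real.log (k + 1) - Real.log k) ≤ 1 := by
  have hk' : (1 : ℝ) ≤ k := by exact_mod_cast hk
  have h0 : (0 : ℝ) < k := by linarith
  rw [← Real.log_div (by linarith) h0.ne']
  calc (k : ℝ) * Real.log ((k + 1) / k) ≤ k * ((k + 1) / k - 1) := by
        gcongr; exact Real.log_le_sub_one_of_pos (by positivity)
    _ = 1 := by field_simp; ring

/-- Telescoping over `Ico N X`: `∑_{N ≤ k < X} (f (k+1) − f k) = f X − f N`. [folklore] -/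
private theorem sum_Ico_succ_sub' (f : ℕ → ℝ) {N X : ℕ} (h : N ≤ X) :
    ∑ k ∈ Ico N X, (f (k + 1) - f k) = f X - f N := by
  induction X, h using Nat.le_induction with
  | base => simp
  | succ X hNX ih => rw [Finset.sum_Ico_succ_top hNX, ih]; ring

/-- **Abel summation against a Chebyshev-type function, sharp form.** Let `w, c : ℕ → ℝ`,
`4 ≤ N ≤ X`, `M(V) = ∑_{1 ≤ n ≤ V} w(n)` with `|M(V)| ≤ B` for all `V`, `∑_{n ≤ X/N} |w(n)| ≤ K`, and
`|∑_{i ≤ k} (c(i) − 1)| ≤ C₁ k/log² k` for all `k ≥ N − 1`. Then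
`|∑_{N ≤ k ≤ X} c(k) M(⌊X/k⌋)/(k log k) − ∑_{N ≤ k ≤ X} M(⌊X/k⌋)/(k log k)| ≤ 3C₁B/log²(N − 1) + C₁K/log³ N`.
[cite: MontgomeryVaughan2007, §2.1] -/
theorem abs_sum_weight_mul_sub_sum_le_sharp (w c : ℕ → ℝ) {N X : ℕ} (hN : 4 ≤ N) (hNX : N ≤ X)
    {B K C₁ : ℝ} (hB0 : 0 ≤ B) (hC₁ : 0 ≤ C₁)
    (hB : ∀ V : ℕ, |∑ n ∈ Icc 1 V, w n| ≤ B)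
    (hK : ∑ n ∈ Icc 1 (X / N), |w n| ≤ K)
    (hD : ∀ k : ℕ, N - 1 ≤ k → |∑ i ∈ range (k + 1), (c i - 1)| ≤ C₁ * k / Real.log k ^ 2) :
    |∑ k ∈ Icc N X, c k * ((∑ n ∈ Icc 1 (X / k), w n) / ((k : ℝ) * Real.log k)) -
        ∑ k ∈ Icc N X, (∑ n ∈ Icc 1 (X / k), w n) / ((k : ℝ) * Real.log k)| ≤
      C₁ * (3 * B) / Real.log (N - 1) ^ 2 + C₁ * K / Real.log N ^ 3 := by
  -- Notation: `F k = M(X/k)/(k log k)`, `g i = c i - 1`, `L = log (N - 1)`.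
  set F : ℕ → ℝ := fun k => (∑ n ∈ Icc 1 (X / k), w n) / ((k : ℝ) * Real.log k) with hF
  set g : ℕ → ℝ := fun i => c i - 1 with hg
  have hN' : (4 : ℝ) ≤ N := by exact_mod_cast hN
  have hNX' : (N : ℝ) ≤ X := by exact_mod_cast hNX
  have hL1 : 1 < Real.log ((N : ℝ) - 1) := by
    rw [Real.lt_log_iff_exp_lt (by linarith)]
    linarith [Real.exp_one_lt_three]
  set L := Real.log ((N : ℝ) - 1) with hLdef
  have hL0 : 0 < L := by linarith
  have hlogN : L ≤ Real.log N := Real.log_le_log (by linarith) (by linarith)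
  have hFle : ∀ k : ℕ, N ≤ k → |F k| ≤ B / (k * Real.log k) := by
    intro k hk
    have hk' : (4 : ℝ) ≤ k := by exact_mod_cast le_trans hN hk
    have hpos : 0 < (k : ℝ) * Real.log k := by
      have := Real.log_pos (by linarith : (1 : ℝ) < k); positivity
    rw [hF]; dsimp only
    rw [abs_div, abs_of_pos hpos]
    exact div_le_div_of_nonneg_right (hB _) hpos.le
  -- Step 1: Abel summation.
  have h1N : N - 1 + 1 = N := by omega
  have hIcc : Icc N X = Ioc (N - 1) X := by
    ext i; simp only [Finset.mem_Icc, Finset.mem_Ioc]; omega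
  have hdiff : ∑ k ∈ Icc N X, c k * F k - ∑ k ∈ Icc N X, F k =
      ∑ i ∈ Ioc (N - 1) X, F i • g i := by
    rw [← Finset.sum_sub_distrib, hIcc]
    refine Finset.sum_congr rfl fun i _ => ?_
    simp only [smul_eq_mul, hg]; ring
  change |∑ k ∈ Icc N X, c k * F k - ∑ k ∈ Icc N X, F k| ≤ _
  rw [hdiff, Finset.sum_Ioc_by_parts F g (by omega : N - 1 < X), h1N]
  -- Step 2: the two boundary terms.
  have ha : |F X • ∑ i ∈ range (X + 1), g i| ≤ C₁ * B / L ^ 2 := by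
    have hX' : (4 : ℝ) ≤ X := by exact_mod_cast le_trans hN hNX
    have hlogX : L ≤ Real.log X := Real.log_le_log (by linarith) (by linarith)
    have hX0 : (X : ℝ) ≠ 0 := by exact_mod_cast (show X ≠ 0 by omega)
    have hlX0 : Real.log X ≠ 0 := (Real.log_pos (by linarith)).ne'
    rw [smul_eq_mul, abs_mul]
    calc |F X| * |∑ i ∈ range (X + 1), g i|
        ≤ B / (X * Real.log X) * (C₁ * X / Real.log X ^ 2) :=
          mul_le_mul (hFle X hNX) (hD X (by omega)) (abs_nonneg _) (by positivity)
      _ = C₁ * B / Real.log X ^ 3 := by field_simp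
      _ ≤ C₁ * B / L ^ 2 := by
          apply div_le_div_of_nonneg_left (by positivity) (by positivity)
          calc L ^ 2 ≤ Real.log X ^ 2 := by gcongr
            _ ≤ Real.log X ^ 3 := pow_le_pow_right₀ (by linarith) (by norm_num)
  have hb : |F N • ∑ i ∈ range N, g i| ≤ C₁ * B / L ^ 2 := by
    have hGN := hD (N - 1) le_rfl
    rw [h1N, Nat.cast_sub (by omega : 1 ≤ N), Nat.cast_one] at hGN
    have hNlog : 0 < (N : ℝ) * Real.log N := mul_pos (by linarith) (by linarith)
    rw [smul_eq_mul, abs_mul]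
    calc |F N| * |∑ i ∈ range N, g i| ≤ B / (N * Real.log N) * (C₁ * (N - 1) / L ^ 2) :=
          mul_le_mul (hFle N le_rfl) hGN (abs_nonneg _) (by positivity)
      _ = C₁ * B / L ^ 2 * ((N - 1) / (N * Real.log N)) := by ring
      _ ≤ C₁ * B / L ^ 2 * 1 := by
          gcongr
          rw [div_le_one hNlog]
          nlinarith
      _ = C₁ * B / L ^ 2 := mul_one _
  -- Step 3: the variation sum.
  have hc : |∑ i ∈ Ioc (N - 1) (X - 1), (F (i + 1) - F i) • ∑ j ∈ range (i + 1), g j| ≤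
      C₁ * K / Real.log N ^ 3 + C₁ * B / L ^ 2 := by
    have hIco : Ioc (N - 1) (X - 1) = Ico N X := by
      ext i; simp only [Finset.mem_Ioc, Finset.mem_Ico]; omega
    rw [hIco]
    have hIcc1 : ∀ V, Icc 1 V = Ioc 0 V := fun V => by
      ext n; simp only [Finset.mem_Icc, Finset.mem_Ioc]; omega
    -- per-term bound
    have key : ∀ i ∈ Ico N X, |(F (i + 1) - F i) • ∑ j ∈ range (i + 1), g j| ≤
        C₁ / Real.log N ^ 3 * ∑ n ∈ Ioc (X / (i + 1)) (X / i), |w n| +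
          C₁ * B * (1 / Real.log ((i : ℝ) - 1) ^ 2 - 1 / Real.log ((↑(i + 1) : ℝ) - 1) ^ 2) := by
      intro i hi
      rw [Finset.mem_Ico] at hi
      obtain ⟨hNi, hiX⟩ := hi
      have hi' : (4 : ℝ) ≤ i := by exact_mod_cast le_trans hN hNi
      have hNi' : (N : ℝ) ≤ i := by exact_mod_cast hNi
      have hli : 1 < Real.log i := lt_of_lt_of_le hL1 (Real.log_le_log (by linarith) (by linarith))
      have hlNi : Real.log N ≤ Real.log i := Real.log_le_log (by linarith) hNi'
      have hli1 : Real.log i ≤ Real.log (i + 1) := Real.log_le_log (by linarith) (by linarith)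
      have hlNi1 : Real.log N ≤ Real.log (i + 1) := hlNi.trans hli1
      have hi0 : (i : ℝ) ≠ 0 := by exact_mod_cast (show i ≠ 0 by omega)
      have hli0 : Real.log i ≠ 0 := by positivity
      have hli10 : Real.log (i + 1) ≠ 0 := ne_of_gt (by linarith)
      set p : ℝ := i * Real.log i with hp_def
      set q : ℝ := (i + 1) * Real.log (i + 1) with hq_def
      have hp : 0 < p := by positivity
      have hpq : p ≤ q := by
        simp only [hp_def, hq_def]
        exact mul_le_mul (by linarith) hli1 (by linarith) (by linarith)
      have hq : 0 < q := lt_of_lt_of_le hp hpq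
      have hp0 : p ≠ 0 := hp.ne'
      have hq0 : q ≠ 0 := hq.ne'
      have hqp : q - p ≤ 2 * Real.log (i + 1) := by
        have := mul_log_succ_sub_log_le_one' (k := i) (by omega)
        simp only [hp_def, hq_def]; nlinarith
      -- the jump of `M(X/·)` across `i → i+1`
      set V : ℝ := ∑ n ∈ Ioc (X / (i + 1)) (X / i), |w n| with hV_def
      have hM01 : (∑ n ∈ Icc 1 (X / i), w n) - ∑ n ∈ Icc 1 (X / (i + 1)), w n =
          ∑ n ∈ Ioc (X / (i + 1)) (X / i), w n := by
        rw [hIcc1, hIcc1, sub_eq_iff_eq_add', Finset.sum_Ioc_consecutive _ (Nat.zero_le _)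
          (Nat.div_le_div_left (Nat.le_succ i) (by omega))]
      have hVi : |(∑ n ∈ Icc 1 (X / (i + 1)), w n) - ∑ n ∈ Icc 1 (X / i), w n| ≤ V := by
        rw [abs_sub_comm, hM01]; exact Finset.abs_sum_le_sum_abs _ _
      have hV0 : 0 ≤ V := le_trans (abs_nonneg _) hVi
      have hF1 : F (i + 1) = (∑ n ∈ Icc 1 (X / (i + 1)), w n) / q := by
        simp only [hF, hq_def]; push_cast; rfl
      have hFdiff : F (i + 1) - F i =
          ((∑ n ∈ Icc 1 (X / (i + 1)), w n) - ∑ n ∈ Icc 1 (X / i), w n) / q -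
            (∑ n ∈ Icc 1 (X / i), w n) * ((q - p) / (p * q)) := by
        rw [hF1, show F i = (∑ n ∈ Icc 1 (X / i), w n) / p from rfl]
        field_simp; ring
      have hFabs : |F (i + 1) - F i| ≤ V / q + B * ((q - p) / (p * q)) := by
        rw [hFdiff]
        refine (abs_sub _ _).trans (add_le_add ?_ ?_)
        · rw [abs_div, abs_of_pos hq]; exact div_le_div_of_nonneg_right hVi hq.le
        · have h0 : 0 ≤ (q - p) / (p * q) := div_nonneg (sub_nonneg.2 hpq) (by positivity)
          rw [abs_mul, abs_of_nonneg h0]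
          exact mul_le_mul_of_nonneg_right (hB _) h0
      have hG := hD i (by omega)
      have h4 := inv_mul_log_pow_three_le (k := i) (by omega)
      have hlN0 : 0 < Real.log N := by linarith
      have h1 : (i : ℝ) / (q * Real.log i ^ 2) ≤ 1 / Real.log N ^ 3 := by
        rw [div_le_div_iff₀ (by positivity) (by positivity), one_mul]
        calc (i : ℝ) * Real.log N ^ 3 = i * (Real.log N * Real.log N ^ 2) := by ring
          _ ≤ (i + 1) * (Real.log (i + 1) * Real.log i ^ 2) := by gcongr <;> linarith
          _ = q * Real.log i ^ 2 := by simp only [hq_def]; ring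
      have h2 : (q - p) * i / (p * q * Real.log i ^ 2) ≤
          1 / Real.log ((i : ℝ) - 1) ^ 2 - 1 / Real.log i ^ 2 :=
        calc (q - p) * i / (p * q * Real.log i ^ 2)
            ≤ 2 * Real.log (i + 1) * i / (p * q * Real.log i ^ 2) := by gcongr
          _ = 2 / ((i + 1) * Real.log i ^ 3) := by simp only [hp_def, hq_def]; field_simp
          _ ≤ 2 / (i * Real.log i ^ 3) := by gcongr; linarith
          _ ≤ _ := by rw [div_eq_mul_one_div 2]; linarith
      rw [smul_eq_mul, abs_mul]
      calc |F (i + 1) - F i| * |∑ j ∈ range (i + 1), g j|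
          ≤ (V / q + B * ((q - p) / (p * q))) * (C₁ * i / Real.log i ^ 2) :=
            mul_le_mul hFabs hG (abs_nonneg _) (le_trans (abs_nonneg _) hFabs)
        _ = C₁ * V * (i / (q * Real.log i ^ 2)) +
              C₁ * B * ((q - p) * i / (p * q * Real.log i ^ 2)) := by ring
        _ ≤ C₁ * V * (1 / Real.log N ^ 3) +
              C₁ * B * (1 / Real.log ((i : ℝ) - 1) ^ 2 - 1 / Real.log i ^ 2) :=
            add_le_add (mul_le_mul_of_nonneg_left h1 (by positivity))
              (mul_le_mul_of_nonneg_left h2 (by positivity))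
        _ = _ := by push_cast; rw [add_sub_cancel_right]; ring
    calc |∑ i ∈ Ico N X, (F (i + 1) - F i) • ∑ j ∈ range (i + 1), g j|
        ≤ ∑ i ∈ Ico N X, |(F (i + 1) - F i) • ∑ j ∈ range (i + 1), g j| :=
          Finset.abs_sum_le_sum_abs _ _
      _ ≤ ∑ i ∈ Ico N X, (C₁ / Real.log N ^ 3 * ∑ n ∈ Ioc (X / (i + 1)) (X / i), |w n| +
          C₁ * B * (1 / Real.log ((i : ℝ) - 1) ^ 2 - 1 / Real.log ((↑(i + 1) : ℝ) - 1) ^ 2)) :=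
          Finset.sum_le_sum key
      _ = C₁ / Real.log N ^ 3 * ∑ n ∈ Ioc 1 (X / N), |w n| +
          C₁ * B * (1 / L ^ 2 - 1 / Real.log ((X : ℝ) - 1) ^ 2) := by
          rw [Finset.sum_add_distrib, ← Finset.mul_sum, ← Finset.mul_sum,
            sum_Ico_sum_Ioc_div_eq _ (by omega) hNX]
          congr 1
          have := sum_Ico_succ_sub' (fun k : ℕ => 1 / Real.log ((k : ℝ) - 1) ^ 2) hNX
          rw [← neg_inj, ← Finset.sum_neg_distrib] at this
          simp only [neg_sub] at this
          rw [this]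
      _ ≤ C₁ / Real.log N ^ 3 * K + C₁ * B * (1 / L ^ 2 - 0) := by
          gcongr
          · exact le_trans (Finset.sum_le_sum_of_subset_of_nonneg Finset.Ioc_subset_Icc_self
              (fun _ _ _ => abs_nonneg _)) hK
          · positivity
      _ = C₁ * K / Real.log N ^ 3 + C₁ * B / L ^ 2 := by
          rw [sub_zero, ← div_eq_mul_one_div, div_mul_eq_mul_div]
  -- Step 4: assemble.
  have h0 : 0 ≤ C₁ * B / L ^ 2 := by positivity
  calc _ ≤ |F X • ∑ i ∈ range (X + 1), g i - F N • ∑ i ∈ range N, g i| +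
        |∑ i ∈ Ioc (N - 1) (X - 1), (F (i + 1) - F i) • ∑ j ∈ range (i + 1), g j| := abs_sub _ _
    _ ≤ |F X • ∑ i ∈ range (X + 1), g i| + |F N • ∑ i ∈ range N, g i| +
        |∑ i ∈ Ioc (N - 1) (X - 1), (F (i + 1) - F i) • ∑ j ∈ range (i + 1), g j| := by
          gcongr; exact abs_sub _ _
    _ ≤ C₁ * B / L ^ 2 + C₁ * B / L ^ 2 + (C₁ * K / Real.log N ^ 3 + C₁ * B / L ^ 2) := by gcongr
    _ = C₁ * (3 * B) / L ^ 2 + C₁ * K / Real.log N ^ 3 := by ring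

end HyperbolaAbel

end Literature.NumberTheory.LFunctions
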